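import Literature.Geometry.Kaehler.ComplexTorusHodgeGroupSigmaPiSemisimple
import HarnessLib

/-!
# The derived series of `Hg(∏ₖ X_k)(ℂ)` versus the factors: `Dⁿ(Hg(∏ₖ X_k)(ℂ)) ≤ ∏ₖ Dⁿ(Hg(X_k)(ℂ))` with SURJECTIVE
# projections; `Hg(∏ₖ X_k)(ℂ)` solvable ⟺ every `Hg(X_k)(ℂ)` solvable; Gordon's lemma for `(∏ₖ X_k) × (∏ₗ Y_l)` with
# perfect `Hg(X_k)` and solvable `Hg(Y_l)` — every finite family of complex tori of arbitrary dimensions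

Layer `Literature/Geometry/Kaehler`, namespace `Literature.Geometry.Kaehler.ComplexTorus`; lane `lit-hodgefound`
(Track 2 foundations library), Layer A3/A4; prover seat `lit-hodgefound-p17` (generation 38, self-proposed row g38-#1,
the finite-family form of g37-#6 `ComplexTorusHodgeGroupProductDerivedSeries`, through g37-#3
`ComplexTorusHodgeGroupSigmaPiProjectionsSurjective` (`pr_k : Hg(∏ₖ X_k)(ℂ) → Hg(X_k)(ℂ)` is onto) and g37-#8
`ComplexTorusHodgeGroupSigmaPiSemisimple` (`n = 1`)). THEOREMS ONLY (no definition, no instance, no notation, no named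
fact; D-0026 net debt 0). The product torus is p10's dependent product `sigmaPiPeriod Ψ` of a family
`Ψ : ∀ k, (σ k → ℝ) ≃L[ℝ] F k` indexed by a `Fintype κ`; block-diagonal elements are p36's `sigmaBlockDiagSL σ ℂ A`. The
derived series of a subgroup `H ≤ SL(V)(ℂ)` is written `(derivedSeries ↥H n).map H.subtype` (Mathlib's `derivedSeries`
of the group `↥H`, pushed into `SL(V)(ℂ)`), as in g37-#5/#6; solvability is Mathlib's `IsSolvable ↥H`.

## Sources, verbatim

* B. Moonen, Yu. G. Zarhin [MoonenZarhin1999LowDim], held `paper:arxiv-math_9901113`, §3 (3.1) (p0006 L25–L28):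
  "`Hg(X₁ × X₂)` is an algebraic subgroup of `Hg(X₁) × Hg(X₂)`; the two projections are surjective" (any finite number
  of factors by induction); §1: "`X` is of CM-type […] iff `Hg(X)` is a torus"; §3 Theorem (2) (p0006 L74–L78):
  "Suppose `X₁` has no factors of Type IV and `X₂` is of CM-type. Then […] `Hg(X₁ × X₂) = Hg(X₁) × Hg(X₂)`".
* B. B. Gordon [Gordon1997], held `paper:arxiv-alg-geom_9709030`, §2.16 Proposition (Goursat's Lemma), first bullet
  (p0012 L112–L119); §2.12 Proposition ("of CM-type if and only if `Hg(A)` is an algebraic torus"); §3 Theorem, proof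
  (p0014 L33–L37: "`Hg(A) = Hg(B) × Hg(C)`" for `Hg(B)` a torus and `Hg(C)` semisimple).
* H. Imai [Imai1976HodgeGroups], §1 (p. 367: "`Hg(A₁ × A₂) ⊂ Hg(A₁) × Hg(A₂)`"), §2 Proposition (p. 370: "Write
  `H = H′·D` […] `q(H′) = q([H, H]) = [q(H), q(H)]`" — the projection of the derived group is the derived group of the
  projection).

## What is proved (every finite family of complex tori `(X_k)_{k ∈ κ}`)

* §1 INCLUSION: **`map_derivedSeries_hodgeGroupC_sigmaPi_le`** — `Dⁿ(Hg(∏ₖ X_k)(ℂ)) ≤ diag(∏ₖ Dⁿ(Hg(X_k)(ℂ)))` for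
  every `n`; the blocks of an element of `Dⁿ(Hg(∏ₖ X_k)(ℂ))` lie in the `Dⁿ(Hg(X_k)(ℂ))`
  (`apply_mem_map_derivedSeries_of_sigmaBlockDiagSL_mem`).
* §2 SURJECTIVE PROJECTIONS (Imai's "`q([H, H]) = [q(H), q(H)]`", all `n`):
  **`exists_sigmaBlockDiagSL_mem_map_derivedSeries_apply_eq`** — every `g ∈ Dⁿ(Hg(X_k)(ℂ))` is the `k`-th block of
  some `diag(A_l)_l ∈ Dⁿ(Hg(∏ₖ X_k)(ℂ))` (with all `A_l ∈ Dⁿ(Hg(X_l)(ℂ))`);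
  `mem_map_derivedSeries_iff_exists_sigmaBlockDiagSL_mem`.
* §3 TRANSFERS: **`map_derivedSeries_hodgeGroupC_sigmaPi_eq_bot_iff`** (`Dⁿ(Hg(∏ₖ X_k)) = 1 ⟺ ∀ k, Dⁿ(Hg(X_k)) = 1`),
  **`isSolvable_hodgeGroupC_sigmaPi_iff`** (`Hg(∏ₖ X_k)(ℂ)` solvable ⟺ every `Hg(X_k)(ℂ)` solvable), and for families
  of abelian varieties **`IsAbelianVariety.isSolvable_hodgeGroupC_sigmaPi_iff`** (`Hg(∏ₖ X_k)(ℂ)` solvable ⟺ every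
  `X_k` of CM-type, through p22's `IsAbelianVariety.isSolvable_hodgeGroupC_iff`).
* §4 GORDON'S LEMMA FOR TWO FAMILIES: **`IsRiemannForm.hodgeGroupC_sigmaPi_prod_sigmaPi_eq_blockDiagProd_of_isSolvable`**
  — `Hg((∏ₖ X_k) × (∏ₗ Y_l))(ℂ) = Hg(∏ₖ X_k)(ℂ) × Hg(∏ₗ Y_l)(ℂ)` for polarised `X_k` with perfect `Hg(X_k)(ℂ)` and ANY
  tori `Y_l` with solvable `Hg(Y_l)(ℂ)` (g37-#5's perfect × solvable splitting for the perfect group `Hg(∏ₖ X_k)(ℂ)` of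
  g37-#8 and the solvable group `Hg(∏ₗ Y_l)(ℂ)` of §3); real points; the single-`Y` form; and the stable-nondegeneracy
  transfer `IsRiemannForm.forall_divisorClasses_powPeriod_sigmaPi_prod_sigmaPi_eq_hodgeClasses_of_isSolvable`.

## References

* [MoonenZarhin1999LowDim] B. Moonen, Yu. G. Zarhin, Math. Ann. 315 (1999), §1, §3 (3.1), §3 Theorem (2).
* [Gordon1997] B. B. Gordon, *A survey of the Hodge conjecture for abelian varieties* (alg-geom/9709030), §2.12, §2.16, §3, Thm. 7.6.2.
* [Imai1976HodgeGroups] H. Imai, *On the Hodge groups of some abelian varieties*, Kodai Math. Sem. Rep. 27 (1976), §1–§2.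
-/

noncomputable section

open Matrix Module
open scoped MatrixGroups

namespace Literature.Geometry.Kaehler

namespace ComplexTorus

/-! ### Generic group lemmas (file-local): the derived series of a subgroup, pushed into the ambient group -/

section DerivedSeries

variable {G : Type*} [Group G] (H : Subgroup G)

/-- `D⁰(H) = H` inside `G`. [cite: Gordon1997, §2.16 Proposition] -/
private theorem hsd_map_subtype_derivedSeries_zero : (derivedSeries H 0).map H.subtype = H := by
  rw [derivedSeries_zero, ← MonoidHom.range_eq_map, Subgroup.range_subtype]

/-- `Dⁿ⁺¹(H) = (Dⁿ(H), Dⁿ(H))` inside `G`. [cite: Gordon1997, §2.16 Proposition] -/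
private theorem hsd_map_subtype_derivedSeries_succ (n : ℕ) :
    (derivedSeries H (n + 1)).map H.subtype =
      ⁅(derivedSeries H n).map H.subtype, (derivedSeries H n).map H.subtype⁆ := by
  rw [derivedSeries_succ, Subgroup.map_commutator]

/-- `H` is solvable iff some `Dⁿ(H)` is trivial (inside `G`). [cite: Gordon1997, §2.12 Proposition] -/
private theorem hsd_isSolvable_iff_exists_map_subtype_derivedSeries_eq_bot :
    IsSolvable H ↔ ∃ n, (derivedSeries H n).map H.subtype = ⊥ := by
  rw [isSolvable_def]
  exact exists_congr fun n ↦ ((derivedSeries H n).map_eq_bot_iff_of_injective H.subtype_injective).symm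

variable {H} in
/-- The derived series is antitone: `Dᵐ(H) = 1 ⟹ Dⁿ(H) = 1` for `m ≤ n`. [cite: Gordon1997, §2.16 Proposition] -/
private theorem hsd_map_subtype_derivedSeries_eq_bot_of_le {m n : ℕ} (hmn : m ≤ n)
    (h : (derivedSeries H m).map H.subtype = ⊥) : (derivedSeries H n).map H.subtype = ⊥ := by
  rw [(derivedSeries H m).map_eq_bot_iff_of_injective H.subtype_injective] at h
  rw [(derivedSeries H n).map_eq_bot_iff_of_injective H.subtype_injective]
  exact le_bot_iff.1 ((derivedSeries_antitone (G := ↥H) hmn).trans h.le)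

/-- The commutator of two images of products of subgroups lies in the image of the product of the commutators.
[cite: Imai1976HodgeGroups, §2 Proposition (p. 370)] -/
private theorem hsd_commutator_map_pi_le {K : Type*} {Gs : K → Type*} [∀ k, Group (Gs k)] {G' : Type*} [Group G']
    (f : (∀ k, Gs k) →* G') (A B : ∀ k, Subgroup (Gs k)) :
    ⁅(Subgroup.pi Set.univ A).map f, (Subgroup.pi Set.univ B).map f⁆ ≤
      (Subgroup.pi Set.univ fun k ↦ ⁅A k, B k⁆).map f := by
  rw [← Subgroup.map_commutator]
  exact Subgroup.map_mono (Subgroup.commutator_pi_pi_le A B)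

end DerivedSeries

variable {κ : Type*} [Fintype κ] [DecidableEq κ] {σ : κ → Type*} [∀ k, Fintype (σ k)] [∀ k, DecidableEq (σ k)]
  {F : κ → Type*} [∀ k, NormedAddCommGroup (F k)] [∀ k, NormedSpace ℂ (F k)] (Ψ : ∀ k, (σ k → ℝ) ≃L[ℝ] F k)

/-! ## §1 `Dⁿ(Hg(∏ₖ X_k)(ℂ)) ≤ diag(∏ₖ Dⁿ(Hg(X_k)(ℂ)))` -/

section Inclusion

/-- **`Dⁿ(Hg(∏ₖ X_k)(ℂ)) ≤ diag(∏ₖ Dⁿ(Hg(X_k)(ℂ)))`** (`n = 0` is "`Hg(∏ₖ X_k) ⊂ ∏ₖ Hg(X_k)`", p10's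
`hodgeGroupC_sigmaPi_le`; the step is "the commutator of a product lies in the product of the commutators").
[cite: Imai1976HodgeGroups, §1 (p. 367) and §2 Proposition (p. 370)] [cite: MoonenZarhin1999LowDim, §3 (3.1)] -/
theorem map_derivedSeries_hodgeGroupC_sigmaPi_le (n : ℕ) :
    (derivedSeries ↥(hodgeGroupC (sigmaPiPeriod Ψ)) n).map (hodgeGroupC (sigmaPiPeriod Ψ)).subtype ≤
      (Subgroup.pi Set.univ fun k ↦ (derivedSeries ↥(hodgeGroupC (Ψ k)) n).map (hodgeGroupC (Ψ k)).subtype).map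
        (sigmaBlockDiagSL σ ℂ) := by
  induction n with
  | zero =>
    have e : (fun k ↦ (derivedSeries ↥(hodgeGroupC (Ψ k)) 0).map (hodgeGroupC (Ψ k)).subtype) =
        fun k ↦ hodgeGroupC (Ψ k) :=
      funext fun k ↦ hsd_map_subtype_derivedSeries_zero _
    rw [hsd_map_subtype_derivedSeries_zero, e]
    exact hodgeGroupC_sigmaPi_le Ψ
  | succ n ih =>
    have e : (fun k ↦ (derivedSeries ↥(hodgeGroupC (Ψ k)) (n + 1)).map (hodgeGroupC (Ψ k)).subtype) =
        fun k ↦ ⁅(derivedSeries ↥(hodgeGroupC (Ψ k)) n).map (hodgeGroupC (Ψ k)).subtype,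
          (derivedSeries ↥(hodgeGroupC (Ψ k)) n).map (hodgeGroupC (Ψ k)).subtype⁆ :=
      funext fun k ↦ hsd_map_subtype_derivedSeries_succ _ n
    rw [hsd_map_subtype_derivedSeries_succ, e]
    exact (Subgroup.commutator_mono ih ih).trans (hsd_commutator_map_pi_le _ _ _)

/-- The blocks of an element of `Dⁿ(Hg(∏ₖ X_k)(ℂ))` lie in the `Dⁿ(Hg(X_k)(ℂ))`.
[cite: Imai1976HodgeGroups, §2 Proposition (p. 370)] [cite: MoonenZarhin1999LowDim, §3 (3.1)] -/
theorem apply_mem_map_derivedSeries_of_sigmaBlockDiagSL_mem (n : ℕ) {A : ∀ k, SpecialLinearGroup (σ k) ℂ}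
    (h : sigmaBlockDiagSL σ ℂ A ∈
      (derivedSeries ↥(hodgeGroupC (sigmaPiPeriod Ψ)) n).map (hodgeGroupC (sigmaPiPeriod Ψ)).subtype) (k : κ) :
    A k ∈ (derivedSeries ↥(hodgeGroupC (Ψ k)) n).map (hodgeGroupC (Ψ k)).subtype := by
  obtain ⟨B, hB, hBA⟩ := Subgroup.mem_map.1 (map_derivedSeries_hodgeGroupC_sigmaPi_le Ψ n h)
  obtain rfl : B = A := sigmaBlockDiagSL_injective hBA
  exact (Subgroup.mem_pi _).1 hB k (Set.mem_univ k)

/-- Every element of `Dⁿ(Hg(∏ₖ X_k)(ℂ))` is block-diagonal, `diag(A_k)_k` with `A_k ∈ Dⁿ(Hg(X_k)(ℂ))`.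
[cite: Imai1976HodgeGroups, §1 (p. 367) and §2 Proposition (p. 370)] -/
theorem exists_eq_sigmaBlockDiagSL_of_mem_map_derivedSeries (n : ℕ) {M : SpecialLinearGroup (Σ k, σ k) ℂ}
    (hM : M ∈ (derivedSeries ↥(hodgeGroupC (sigmaPiPeriod Ψ)) n).map (hodgeGroupC (sigmaPiPeriod Ψ)).subtype) :
    ∃ A : ∀ k, SpecialLinearGroup (σ k) ℂ, sigmaBlockDiagSL σ ℂ A = M ∧
      ∀ k, A k ∈ (derivedSeries ↥(hodgeGroupC (Ψ k)) n).map (hodgeGroupC (Ψ k)).subtype := by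
  obtain ⟨A, hA, rfl⟩ := Subgroup.mem_map.1 (map_derivedSeries_hodgeGroupC_sigmaPi_le Ψ n hM)
  exact ⟨A, rfl, fun k ↦ (Subgroup.mem_pi _).1 hA k (Set.mem_univ k)⟩

end Inclusion

/-! ## §2 The projections `Dⁿ(Hg(∏ₖ X_k)(ℂ)) → Dⁿ(Hg(X_k)(ℂ))` are onto -/

section Surjective

/-- **Every `g ∈ Dⁿ(Hg(X_k)(ℂ))` is the `k`-th block of some `diag(A_l)_l ∈ Dⁿ(Hg(∏ₖ X_k)(ℂ))`** (`n = 0`: `pr_k` is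
onto, g37-#3; step: the commutator of two lifts is a lift of the commutator and lies in the next term of the derived
series of `Hg(∏ₖ X_k)(ℂ)` — Imai's "`q([H, H]) = [q(H), q(H)]`").
[cite: Imai1976HodgeGroups, §2 Proposition (p. 370)] [cite: MoonenZarhin1999LowDim, §3 (3.1)] [cite: Gordon1997, §2.16 Proposition] -/
theorem exists_sigmaBlockDiagSL_mem_map_derivedSeries_apply_eq (n : ℕ) (k : κ) {g : SpecialLinearGroup (σ k) ℂ}
    (hg : g ∈ (derivedSeries ↥(hodgeGroupC (Ψ k)) n).map (hodgeGroupC (Ψ k)).subtype) :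
    ∃ A : ∀ l, SpecialLinearGroup (σ l) ℂ, sigmaBlockDiagSL σ ℂ A ∈
      (derivedSeries ↥(hodgeGroupC (sigmaPiPeriod Ψ)) n).map (hodgeGroupC (sigmaPiPeriod Ψ)).subtype ∧ A k = g := by
  induction n generalizing g with
  | zero =>
    rw [hsd_map_subtype_derivedSeries_zero] at hg
    rw [hsd_map_subtype_derivedSeries_zero]
    obtain ⟨A, hA, hAk, -⟩ := exists_sigmaBlockDiagSL_mem_hodgeGroupC_sigmaPi_apply_eq Ψ k hg
    exact ⟨A, hA, hAk⟩
  | succ n ih =>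
    rw [hsd_map_subtype_derivedSeries_succ, Subgroup.commutator_def] at hg
    rw [hsd_map_subtype_derivedSeries_succ]
    refine Subgroup.closure_induction (p := fun g _ ↦ ∃ A : ∀ l, SpecialLinearGroup (σ l) ℂ, sigmaBlockDiagSL σ ℂ A ∈
      ⁅(derivedSeries ↥(hodgeGroupC (sigmaPiPeriod Ψ)) n).map (hodgeGroupC (sigmaPiPeriod Ψ)).subtype,
        (derivedSeries ↥(hodgeGroupC (sigmaPiPeriod Ψ)) n).map (hodgeGroupC (sigmaPiPeriod Ψ)).subtype⁆ ∧ A k = g)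
      ?_ ?_ ?_ ?_ hg
    · rintro _ ⟨a, ha, b, hb, rfl⟩
      obtain ⟨A, hA, hAk⟩ := ih ha
      obtain ⟨B, hB, hBk⟩ := ih hb
      refine ⟨A * B * A⁻¹ * B⁻¹, ?_, ?_⟩
      · rw [map_mul, map_mul, map_mul, map_inv, map_inv]
        exact Subgroup.commutator_mem_commutator hA hB
      · rw [commutatorElement_def, ← hAk, ← hBk]
        rfl
    · exact ⟨1, by rw [map_one]; exact one_mem _, rfl⟩
    · rintro x y _ _ ⟨A, hA, rfl⟩ ⟨B, hB, rfl⟩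
      exact ⟨A * B, by rw [map_mul]; exact mul_mem hA hB, rfl⟩
    · rintro x _ ⟨A, hA, rfl⟩
      exact ⟨A⁻¹, by rw [map_inv]; exact inv_mem hA, rfl⟩

/-- The lift of §2 has ALL its blocks in the `Dⁿ(Hg(X_l)(ℂ))`. [cite: Imai1976HodgeGroups, §2 Proposition (p. 370)]
[cite: MoonenZarhin1999LowDim, §3 (3.1)] -/
theorem exists_sigmaBlockDiagSL_mem_map_derivedSeries_apply_eq_forall_mem (n : ℕ) (k : κ)
    {g : SpecialLinearGroup (σ k) ℂ} (hg : g ∈ (derivedSeries ↥(hodgeGroupC (Ψ k)) n).map (hodgeGroupC (Ψ k)).subtype) :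
    ∃ A : ∀ l, SpecialLinearGroup (σ l) ℂ, sigmaBlockDiagSL σ ℂ A ∈
      (derivedSeries ↥(hodgeGroupC (sigmaPiPeriod Ψ)) n).map (hodgeGroupC (sigmaPiPeriod Ψ)).subtype ∧ A k = g ∧
        ∀ l, A l ∈ (derivedSeries ↥(hodgeGroupC (Ψ l)) n).map (hodgeGroupC (Ψ l)).subtype := by
  obtain ⟨A, hA, hAk⟩ := exists_sigmaBlockDiagSL_mem_map_derivedSeries_apply_eq Ψ n k hg
  exact ⟨A, hA, hAk, apply_mem_map_derivedSeries_of_sigmaBlockDiagSL_mem Ψ n hA⟩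

/-- **The `k`-th projection maps `Dⁿ(Hg(∏ₖ X_k)(ℂ))` ONTO `Dⁿ(Hg(X_k)(ℂ))`**: `g ∈ Dⁿ(Hg(X_k)(ℂ))` iff `g` is the
`k`-th block of an element of `Dⁿ(Hg(∏ₖ X_k)(ℂ))`. [cite: Imai1976HodgeGroups, §2 Proposition (p. 370)]
[cite: MoonenZarhin1999LowDim, §3 (3.1)] -/
theorem mem_map_derivedSeries_iff_exists_sigmaBlockDiagSL_mem (n : ℕ) (k : κ) {g : SpecialLinearGroup (σ k) ℂ} :
    g ∈ (derivedSeries ↥(hodgeGroupC (Ψ k)) n).map (hodgeGroupC (Ψ k)).subtype ↔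
      ∃ A : ∀ l, SpecialLinearGroup (σ l) ℂ, sigmaBlockDiagSL σ ℂ A ∈
        (derivedSeries ↥(hodgeGroupC (sigmaPiPeriod Ψ)) n).map (hodgeGroupC (sigmaPiPeriod Ψ)).subtype ∧ A k = g := by
  refine ⟨exists_sigmaBlockDiagSL_mem_map_derivedSeries_apply_eq Ψ n k, ?_⟩
  rintro ⟨A, hA, rfl⟩
  exact apply_mem_map_derivedSeries_of_sigmaBlockDiagSL_mem Ψ n hA k

end Surjective

/-! ## §3 Triviality of `Dⁿ`, solvability: product versus factors -/

section Transfer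

/-- **`Dⁿ(Hg(∏ₖ X_k)(ℂ)) = 1 ⟺ Dⁿ(Hg(X_k)(ℂ)) = 1` for every `k`** (⟹ by the surjective projections, ⟸ by the
inclusion). [cite: MoonenZarhin1999LowDim, §3 (3.1)] [cite: Imai1976HodgeGroups, §2 Proposition (p. 370)] -/
theorem map_derivedSeries_hodgeGroupC_sigmaPi_eq_bot_iff (n : ℕ) :
    (derivedSeries ↥(hodgeGroupC (sigmaPiPeriod Ψ)) n).map (hodgeGroupC (sigmaPiPeriod Ψ)).subtype = ⊥ ↔
      ∀ k, (derivedSeries ↥(hodgeGroupC (Ψ k)) n).map (hodgeGroupC (Ψ k)).subtype = ⊥ := by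
  constructor
  · intro h k
    refine (Subgroup.eq_bot_iff_forall _).2 fun g hg ↦ ?_
    obtain ⟨A, hA, hAk⟩ := exists_sigmaBlockDiagSL_mem_map_derivedSeries_apply_eq Ψ n k hg
    rw [h, Subgroup.mem_bot, ← map_one (sigmaBlockDiagSL σ ℂ)] at hA
    rw [← hAk, sigmaBlockDiagSL_injective hA, Pi.one_apply]
  · intro h
    refine (Subgroup.eq_bot_iff_forall _).2 fun M hM ↦ ?_
    obtain ⟨A, rfl, hA⟩ := exists_eq_sigmaBlockDiagSL_of_mem_map_derivedSeries Ψ n hM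
    have hA1 : A = 1 := funext fun k ↦ by
      have hk := hA k
      rwa [h k, Subgroup.mem_bot] at hk
    rw [hA1, map_one]

/-- **`Hg(∏ₖ X_k)(ℂ)` is solvable iff every `Hg(X_k)(ℂ)` is** (every finite family of complex tori; for abelian
varieties "solvable" is "of CM-type", below). ⟸ uses the uniform exponent `max_k n_k` over the finite index type.
[cite: MoonenZarhin1999LowDim, §3 (3.1) and §1] [cite: Gordon1997, §2.12 Proposition and §2.16 Proposition] -/
theorem isSolvable_hodgeGroupC_sigmaPi_iff :
    IsSolvable ↥(hodgeGroupC (sigmaPiPeriod Ψ)) ↔ ∀ k, IsSolvable ↥(hodgeGroupC (Ψ k)) := by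
  rw [hsd_isSolvable_iff_exists_map_subtype_derivedSeries_eq_bot]
  constructor
  · rintro ⟨n, hn⟩ k
    rw [hsd_isSolvable_iff_exists_map_subtype_derivedSeries_eq_bot]
    exact ⟨n, (map_derivedSeries_hodgeGroupC_sigmaPi_eq_bot_iff Ψ n).1 hn k⟩
  · intro h
    choose n hn using fun k ↦ (hsd_isSolvable_iff_exists_map_subtype_derivedSeries_eq_bot _).1 (h k)
    exact ⟨Finset.univ.sup n, (map_derivedSeries_hodgeGroupC_sigmaPi_eq_bot_iff Ψ _).2 fun k ↦
      hsd_map_subtype_derivedSeries_eq_bot_of_le (Finset.le_sup (Finset.mem_univ k)) (hn k)⟩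

/-- `Hg(∏ₖ X_k)(ℂ)` solvable ⟹ `Hg(X_k)(ℂ)` solvable. [cite: MoonenZarhin1999LowDim, §3 (3.1)] -/
theorem isSolvable_hodgeGroupC_of_sigmaPi (h : IsSolvable ↥(hodgeGroupC (sigmaPiPeriod Ψ))) (k : κ) :
    IsSolvable ↥(hodgeGroupC (Ψ k)) :=
  (isSolvable_hodgeGroupC_sigmaPi_iff Ψ).1 h k

/-- Every `Hg(X_k)(ℂ)` solvable ⟹ `Hg(∏ₖ X_k)(ℂ)` solvable. [cite: MoonenZarhin1999LowDim, §3 (3.1)] -/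
theorem isSolvable_hodgeGroupC_sigmaPi (h : ∀ k, IsSolvable ↥(hodgeGroupC (Ψ k))) :
    IsSolvable ↥(hodgeGroupC (sigmaPiPeriod Ψ)) :=
  (isSolvable_hodgeGroupC_sigmaPi_iff Ψ).2 h

/-- `(Hg(X_k), Hg(X_k))(ℂ) = 1` for every `k` ⟹ `Hg(∏ₖ X_k)(ℂ)` solvable (indeed commutative, g37-#8's
`commutator_hodgeGroupC_sigmaPi_eq_bot_iff`). [cite: MoonenZarhin1999LowDim, §1 and §3 (3.1)] [cite: Gordon1997, §2.12 Proposition] -/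
theorem isSolvable_hodgeGroupC_sigmaPi_of_commutator_eq_bot (h : ∀ k, ⁅hodgeGroupC (Ψ k), hodgeGroupC (Ψ k)⁆ = ⊥) :
    IsSolvable ↥(hodgeGroupC (sigmaPiPeriod Ψ)) :=
  isSolvable_hodgeGroupC_of_commutator_eq_bot ((commutator_hodgeGroupC_sigmaPi_eq_bot_iff Ψ).2 h)

variable {Ψ} in
/-- **For abelian varieties `X_k`: `Hg(∏ₖ X_k)(ℂ)` is solvable iff every `X_k` is of CM-type** (`End_ℚ(X_k)` contains
a commutative reduced `ℚ`-subalgebra of dimension `2 dim X_k`; per factor by p22's "CM ⟺ `Hg` solvable").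
[cite: Gordon1997, §2.12 Proposition] [cite: MoonenZarhin1999LowDim, §1 and §3 (3.1)] -/
theorem IsAbelianVariety.isSolvable_hodgeGroupC_sigmaPi_iff (hX : ∀ k, IsAbelianVariety (Ψ k)) :
    IsSolvable ↥(hodgeGroupC (sigmaPiPeriod Ψ)) ↔
      ∀ k, ∃ T : Subalgebra ℚ (Matrix (σ k) (σ k) ℚ), T ≤ endAlgRat (Ψ k) ∧ IsReduced T ∧
        (∀ a ∈ T, ∀ b ∈ T, a * b = b * a) ∧ Module.finrank ℚ T = Fintype.card (σ k) := by
  rw [ComplexTorus.isSolvable_hodgeGroupC_sigmaPi_iff]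
  exact forall_congr' fun k ↦ (hX k).isSolvable_hodgeGroupC_iff

variable {Ψ} in
/-- For abelian varieties `X_k`: `Hg(∏ₖ X_k)(ℂ)` solvable ⟺ `(Hg(∏ₖ X_k), Hg(∏ₖ X_k))(ℂ) = 1` (a solvable connected
reductive group is a torus; through the polarised product `IsRiemannForm.sigmaPi`).
[cite: Gordon1997, §2.12 Proposition] [cite: MoonenZarhin1999LowDim, §1] -/
theorem IsAbelianVariety.isSolvable_hodgeGroupC_sigmaPi_iff_commutator_eq_bot (hX : ∀ k, IsAbelianVariety (Ψ k)) :
    IsSolvable ↥(hodgeGroupC (sigmaPiPeriod Ψ)) ↔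
      ⁅hodgeGroupC (sigmaPiPeriod Ψ), hodgeGroupC (sigmaPiPeriod Ψ)⁆ = ⊥ := by
  obtain ⟨ω, hω⟩ := IsAbelianVariety.sigmaPi hX
  exact hω.commutator_hodgeGroupC_eq_bot_iff_isSolvable.symm

end Transfer

/-! ## §4 Gordon's lemma for `(∏ₖ X_k) × (∏ₗ Y_l)`: perfect `Hg(X_k)`, solvable `Hg(Y_l)` -/

section Gordon

variable {Ψ} {ω : ∀ k, F k [⋀^Fin 2]→L[ℝ] ℝ}
  {κ' : Type*} [Fintype κ'] [DecidableEq κ'] {σ' : κ' → Type*} [∀ l, Fintype (σ' l)] [∀ l, DecidableEq (σ' l)]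
  {F' : κ' → Type*} [∀ l, NormedAddCommGroup (F' l)] [∀ l, NormedSpace ℂ (F' l)] (Ψ' : ∀ l, (σ' l → ℝ) ≃L[ℝ] F' l)
  {ι₂ : Type*} [Fintype ι₂] [DecidableEq ι₂] {E₂ : Type*} [NormedAddCommGroup E₂] [NormedSpace ℂ E₂]
  (Φ₂ : (ι₂ → ℝ) ≃L[ℝ] E₂)

/-- **`Hg((∏ₖ X_k) × Y)(ℂ) = Hg(∏ₖ X_k)(ℂ) × Hg(Y)(ℂ)`** for polarised `X_k` with perfect `Hg(X_k)(ℂ)` and ANY torus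
`Y` with SOLVABLE `Hg(Y)(ℂ)` (g37-#5's perfect × solvable splitting for the perfect group `Hg(∏ₖ X_k)(ℂ)` of g37-#8;
for commutative `Hg(Y)(ℂ)` this is g37-#8's `IsRiemannForm.hodgeGroupC_sigmaPi_prod_eq_blockDiagProd_of_commutator_eq`).
[cite: Gordon1997, §2.16 Proposition and §3 Theorem, proof (p0014 L33–L37)] [cite: MoonenZarhin1999LowDim, §3 Theorem (2)] -/
theorem IsRiemannForm.hodgeGroupC_sigmaPi_prod_eq_blockDiagProd_of_isSolvable (hω : ∀ k, IsRiemannForm (Ψ k) (ω k))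
    (h : ∀ k, ⁅hodgeGroupC (Ψ k), hodgeGroupC (Ψ k)⁆ = hodgeGroupC (Ψ k)) (hY : IsSolvable ↥(hodgeGroupC Φ₂)) :
    hodgeGroupC (prodPeriod (sigmaPiPeriod Ψ) Φ₂) = blockDiagProd (hodgeGroupC (sigmaPiPeriod Ψ)) (hodgeGroupC Φ₂) :=
  hodgeGroupC_prod_eq_blockDiagProd_of_commutator_eq_of_isSolvable (sigmaPiPeriod Ψ) Φ₂
    (IsRiemannForm.commutator_hodgeGroupC_sigmaPi_eq_self hω h) hY

/-- **GORDON'S LEMMA FOR TWO FINITE FAMILIES: `Hg((∏ₖ X_k) × (∏ₗ Y_l))(ℂ) = Hg(∏ₖ X_k)(ℂ) × Hg(∏ₗ Y_l)(ℂ)`** for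
polarised `X_k` with perfect `Hg(X_k)(ℂ)` (e.g. no factor of Type IV) and ANY tori `Y_l` with solvable `Hg(Y_l)(ℂ)`
(`Hg(∏ₗ Y_l)(ℂ)` is then solvable, §3). [cite: Gordon1997, §2.16 Proposition and §3 Theorem, proof (p0014 L33–L37)]
[cite: MoonenZarhin1999LowDim, §3 Theorem (2) (p0006 L74–L78)] -/
theorem IsRiemannForm.hodgeGroupC_sigmaPi_prod_sigmaPi_eq_blockDiagProd_of_isSolvable
    (hω : ∀ k, IsRiemannForm (Ψ k) (ω k)) (h : ∀ k, ⁅hodgeGroupC (Ψ k), hodgeGroupC (Ψ k)⁆ = hodgeGroupC (Ψ k))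
    (hY : ∀ l, IsSolvable ↥(hodgeGroupC (Ψ' l))) :
    hodgeGroupC (prodPeriod (sigmaPiPeriod Ψ) (sigmaPiPeriod Ψ')) =
      blockDiagProd (hodgeGroupC (sigmaPiPeriod Ψ)) (hodgeGroupC (sigmaPiPeriod Ψ')) :=
  IsRiemannForm.hodgeGroupC_sigmaPi_prod_eq_blockDiagProd_of_isSolvable (sigmaPiPeriod Ψ') hω h
    (isSolvable_hodgeGroupC_sigmaPi Ψ' hY)

/-- Real points: `Hg((∏ₖ X_k) × (∏ₗ Y_l))(ℝ) = Hg(∏ₖ X_k)(ℝ) × Hg(∏ₗ Y_l)(ℝ)`.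
[cite: Gordon1997, §2.16 Proposition and §3 Theorem, proof (p0014 L33–L37)] [cite: MoonenZarhin1999LowDim, §3 Theorem (2)] -/
theorem IsRiemannForm.hodgeGroup_sigmaPi_prod_sigmaPi_eq_of_isSolvable
    (hω : ∀ k, IsRiemannForm (Ψ k) (ω k)) (h : ∀ k, ⁅hodgeGroupC (Ψ k), hodgeGroupC (Ψ k)⁆ = hodgeGroupC (Ψ k))
    (hY : ∀ l, IsSolvable ↥(hodgeGroupC (Ψ' l))) :
    hodgeGroup (prodPeriod (sigmaPiPeriod Ψ) (sigmaPiPeriod Ψ')) =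
      ((hodgeGroup (sigmaPiPeriod Ψ)).prod (hodgeGroup (sigmaPiPeriod Ψ'))).map (blockDiag (Σ k, σ k) (Σ l, σ' l)) :=
  hodgeGroup_prod_eq_of_hodgeGroupC_prod_eq
    (IsRiemannForm.hodgeGroupC_sigmaPi_prod_sigmaPi_eq_blockDiagProd_of_isSolvable Ψ' hω h hY)

/-- The mirror: `Hg((∏ₗ Y_l) × (∏ₖ X_k))(ℂ) = Hg(∏ₗ Y_l)(ℂ) × Hg(∏ₖ X_k)(ℂ)` (solvable family first).
[cite: Gordon1997, §2.16 Proposition and §3 Theorem, proof (p0014 L33–L37)] [cite: MoonenZarhin1999LowDim, §3 Theorem (2)] -/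
theorem IsRiemannForm.hodgeGroupC_sigmaPi_prod_sigmaPi_eq_blockDiagProd_of_isSolvable_left
    (hω : ∀ k, IsRiemannForm (Ψ k) (ω k)) (h : ∀ k, ⁅hodgeGroupC (Ψ k), hodgeGroupC (Ψ k)⁆ = hodgeGroupC (Ψ k))
    (hY : ∀ l, IsSolvable ↥(hodgeGroupC (Ψ' l))) :
    hodgeGroupC (prodPeriod (sigmaPiPeriod Ψ') (sigmaPiPeriod Ψ)) =
      blockDiagProd (hodgeGroupC (sigmaPiPeriod Ψ')) (hodgeGroupC (sigmaPiPeriod Ψ)) :=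
  hodgeGroupC_prod_eq_blockDiagProd_of_isSolvable_of_commutator_eq (sigmaPiPeriod Ψ') (sigmaPiPeriod Ψ)
    (isSolvable_hodgeGroupC_sigmaPi Ψ' hY) (IsRiemannForm.commutator_hodgeGroupC_sigmaPi_eq_self hω h)

/-- **For families of ABELIAN VARIETIES: `X_k` polarised with perfect `Hg(X_k)(ℂ)`, `Y_l` abelian varieties with
solvable `Hg(Y_l)(ℂ)` (= of CM-type) ⟹ `Hg((∏ₖ X_k) × (∏ₗ Y_l))(ℂ) = Hg(∏ₖ X_k)(ℂ) × Hg(∏ₗ Y_l)(ℂ)`** — Moonen–Zarhin's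
Theorem (2) with "no factors of Type IV" replaced by its consequence "`Hg(X_k)` semisimple" (g37-#9 gives the
Rosati-fixed-centre form). [cite: MoonenZarhin1999LowDim, §3 Theorem (2) (p0006 L74–L78) and §1] [cite: Gordon1997, §2.12 Proposition and §3 Theorem, proof] -/
theorem IsRiemannForm.hodgeGroupC_sigmaPi_prod_sigmaPi_eq_blockDiagProd_of_commutator_eq_of_isCMType
    (hω : ∀ k, IsRiemannForm (Ψ k) (ω k)) (h : ∀ k, ⁅hodgeGroupC (Ψ k), hodgeGroupC (Ψ k)⁆ = hodgeGroupC (Ψ k))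
    (hYav : ∀ l, IsAbelianVariety (Ψ' l))
    (hCM : ∀ l, ∃ T : Subalgebra ℚ (Matrix (σ' l) (σ' l) ℚ), T ≤ endAlgRat (Ψ' l) ∧ IsReduced T ∧
      (∀ a ∈ T, ∀ b ∈ T, a * b = b * a) ∧ Module.finrank ℚ T = Fintype.card (σ' l)) :
    hodgeGroupC (prodPeriod (sigmaPiPeriod Ψ) (sigmaPiPeriod Ψ')) =
      blockDiagProd (hodgeGroupC (sigmaPiPeriod Ψ)) (hodgeGroupC (sigmaPiPeriod Ψ')) :=
  IsRiemannForm.hodgeGroupC_sigmaPi_prod_sigmaPi_eq_blockDiagProd_of_isSolvable Ψ' hω h fun l ↦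
    ((hYav l).isSolvable_hodgeGroupC_iff).2 (hCM l)

/-- **Stable nondegeneracy: `∏ₖ X_k` stably nondegenerate (polarised `X_k`, perfect `Hg(X_k)(ℂ)`) and `∏ₗ Y_l` stably
nondegenerate with solvable `Hg(Y_l)(ℂ)` ⟹ `(∏ₖ X_k) × (∏ₗ Y_l)` stably nondegenerate** (Hazama's product theorem,
g37-#5's solvable form). [cite: Gordon1997, Thm. 7.6.2 and p0021 L22–L25, §2.16 Proposition] [cite: MoonenZarhin1999LowDim, §3 Theorem (2) and §1] -/
theorem IsRiemannForm.forall_divisorClasses_powPeriod_sigmaPi_prod_sigmaPi_eq_hodgeClasses_of_isSolvable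
    (hω : ∀ k, IsRiemannForm (Ψ k) (ω k)) (h : ∀ k, ⁅hodgeGroupC (Ψ k), hodgeGroupC (Ψ k)⁆ = hodgeGroupC (Ψ k))
    (hY : ∀ l, IsSolvable ↥(hodgeGroupC (Ψ' l)))
    (hX : ∀ n p, divisorClasses (powPeriod (sigmaPiPeriod Ψ) n) p = hodgeClasses (powPeriod (sigmaPiPeriod Ψ) n) p)
    (hYs : ∀ n p, divisorClasses (powPeriod (sigmaPiPeriod Ψ') n) p = hodgeClasses (powPeriod (sigmaPiPeriod Ψ') n) p) :
    ∀ n p, divisorClasses (powPeriod (prodPeriod (sigmaPiPeriod Ψ) (sigmaPiPeriod Ψ')) n) p =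
      hodgeClasses (powPeriod (prodPeriod (sigmaPiPeriod Ψ) (sigmaPiPeriod Ψ')) n) p :=
  forall_divisorClasses_powPeriod_prod_eq_hodgeClasses_of_commutator_eq_of_isSolvable
    (IsRiemannForm.commutator_hodgeGroupC_sigmaPi_eq_self hω h) (isSolvable_hodgeGroupC_sigmaPi Ψ' hY) hX hYs

/-- Single solvable factor: `∏ₖ X_k` stably nondegenerate (polarised, perfect `Hg(X_k)(ℂ)`) and `Y` stably nondegenerate
with solvable `Hg(Y)(ℂ)` ⟹ `(∏ₖ X_k) × Y` stably nondegenerate. [cite: Gordon1997, Thm. 7.6.2 and §2.16 Proposition]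
[cite: MoonenZarhin1999LowDim, §3 Theorem (2)] -/
theorem IsRiemannForm.forall_divisorClasses_powPeriod_sigmaPi_prod_eq_hodgeClasses_of_isSolvable
    (hω : ∀ k, IsRiemannForm (Ψ k) (ω k)) (h : ∀ k, ⁅hodgeGroupC (Ψ k), hodgeGroupC (Ψ k)⁆ = hodgeGroupC (Ψ k))
    (hY : IsSolvable ↥(hodgeGroupC Φ₂))
    (hX : ∀ n p, divisorClasses (powPeriod (sigmaPiPeriod Ψ) n) p = hodgeClasses (powPeriod (sigmaPiPeriod Ψ) n) p)
    (hYs : ∀ n p, divisorClasses (powPeriod Φ₂ n) p = hodgeClasses (powPeriod Φ₂ n) p) :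
    ∀ n p, divisorClasses (powPeriod (prodPeriod (sigmaPiPeriod Ψ) Φ₂) n) p =
      hodgeClasses (powPeriod (prodPeriod (sigmaPiPeriod Ψ) Φ₂) n) p :=
  forall_divisorClasses_powPeriod_prod_eq_hodgeClasses_of_commutator_eq_of_isSolvable
    (IsRiemannForm.commutator_hodgeGroupC_sigmaPi_eq_self hω h) hY hX hYs

end Gordon

end ComplexTorus

end Literature.Geometry.Kaehler

end
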